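import Mathlib
import HarnessLib
import Summits.NavierStokesRegularity.NavierStokesRegularity.Theorems.UnthreadedRigidityDoorUnthreadedRigidityVirialHornOrderTwoBracket
import Summits.NavierStokesRegularity.NavierStokesRegularity.Theorems.UnthreadedRigidityDoorUnthreadedRigidityThreadingJetsSplitDefs
import Summits.NavierStokesRegularity.NavierStokesRegularity.Theorems.UnthreadedRigidityDoorUnthreadedRigidityVirialHornAngularTwo

/-!
# Route `UnthreadedRigidityDoor`, item `UnthreadedRigidity` (W2, stmt-NavierStokesRegularity-27585) — LINE g11-1 «VIRIAL HORN»: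
# ★ (F2) THE ORDER-TWO LAW OF A SEPARABLE SHELL — half (A) `ThreadingJets.OrderTwoLawSlice` BY NAME

For the separable shell `u₀ = curl curl (H(|y|) Y(y) y)` of a solid harmonic `Y` of degree `l ≥ 1` with a virial-admissible profile
`H(r) = h(r²)` and ANY smooth pressure slice `p₀`, the formal second threading jet about the centre is
`c₂(y) = K(|y|) · ( α(|y|)² {Y,|∇Y|²}(y) − {Y, y·∇p₀}(y) )`, `α = strainAmpL l H = rH′ + (l+1)H`, `K = vortAmpL l H = H″ + 2(l+1)H′/r`
(VIRIAL HORN card §1 (F2); director-ns dss_146 split: (A) = this file, (B′) `VirialLemmaSlice` = ns-crc-p1 g8, glue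
`orderTwoSliceLawGeneric_of_split` in `…ThreadingJetsSplit`).
* `orderTwoLaw_centred` — the law about the centre with the profiles `a(s) = 2sh′ + (l+1)h`, `b = 2lh′`, `c = 2a′ + b` of `s = |y|²`
  (assembly of `fluxJetTwo_shell_structure` (part 1) with the bracket calculus of part 2 and the radial identity `l(l+1)h + bs − la = 0`);
* `strainAmpL_eq_of_sq`, `vortAmpL_eq_of_sq` — the read-off `α(r) = a(r²)`, `K(r) = c(r²)` for `r > 0`;
* `fluxJetTwo_sepShellL_translate` — the jet about `x₀` is the centred jet of the centred shell with the translated pressure;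
* ★ `orderTwoLawSlice_holds : ThreadingJets.OrderTwoLawSlice`;
* `fluxJetTwo_sepShell_eq` — the `l = 2` reading in the g10-2 PROFILE HORN vocabulary (`sepShell H Q x₀`, `vortAmp`, `strainAmp`,
  `𝒜(Y_Q) = 16 D_Q` by engine-1's `angForm_quadY`): `c₂ = K(16α² D_Q − {Y_Q, y·∇p₀})` — what bridge PH's slice identity
  `HornSliceIdentityTwo` needs besides the `l = 2` pressure bracket `{Y_Q, y·∇p₀}`.

HONEST LABEL: explicit-field calculus (an L-part) on a RUNG line about SPECIAL separable data; with (B′) and the glue it yields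
`OrderTwoSliceLawGeneric` / V-W, not V as typed (residual R1 «generic profile», ns-crc-p1 g8 07:45:25Z); `UnthreadedRigidity` (27585),
W2 and NS regularity remain OPEN; nothing here is a statement about solutions of the Navier–Stokes equations.
`--supports stmt-NavierStokesRegularity-27585` (helper); ns-crc-p2 g8.  [cite: MajdaBertozziCUP2002, §1.1, §2.1]
-/

-- the summit and its single sub-problem share the name (CONVENTIONS §1)
set_option linter.dupNamespace false

namespace Summit.NavierStokesRegularity.NavierStokesRegularity.Theorems.UnthreadedRigidity.VirialHorn

open scoped Topology Laplacian
open Filter Set Function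
open Summit.NavierStokesRegularity.NavierStokesRegularity.Theorems.UnthreadedRigidity.ProfileHorn (E3)
open Literature.Analysis.FluidPDE

/-! ## §5 ★ The ORDER-TWO LAW about the centre -/

/-- ★ THE ORDER-TWO LAW OF A SEPARABLE SHELL, CENTRED FORM.  For the shell `P = curl curl((h(|y|²)Y)y)` of a solid harmonic `Y` of
degree `l ≥ 1` (smooth, divergence free) and any smooth pressure slice `p`, with the radial profiles
`a(s) = 2 s h′ + (l+1) h` (so `P = a∇Y − (bY)y`, `b = 2 l h′`) and `c = 2a′ + b` (so `curl P = −c(∇Y × y)`):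
`fluxJetTwo P p 0 y = c(|y|²) · ( a(|y|²)² {Y,|∇Y|²}(y) − {Y, y·∇p}(y) )`.
Assembly of `fluxJetTwo_shell_structure`: `⟪∇Y, curl u₁⟫ = c a {Y,|∇Y|²}` (§2–§3) and
`{Y, ⟪u₁,·⟫} = (c a|y|² − 2|y|²aa′ − (l−1)a²){Y,|∇Y|²} − {Y, y·∇p}` (§1, §4), closed by the radial identity
`l(l+1)h + b s − l a = 0`. [cite: MajdaBertozziCUP2002, §1.1, §2.1] -/
theorem orderTwoLaw_centred {l : ℕ} {Y : E3 → ℝ} {h : ℝ → ℝ} {P : E3 → E3} {p : E3 → ℝ} {a b c : ℝ → ℝ}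
    (hh : ContDiff ℝ (⊤ : ℕ∞) h) (hY : IsSolidHarmonic l Y) (hl : 1 ≤ l)
    (hPe : P = curl (curl (fun z : E3 => (h (‖z‖ ^ 2) * Y z) • z)))
    (hP : ContDiff ℝ (⊤ : ℕ∞) P) (hdiv : VectorCalculus.IsDivFree P) (hp : ContDiff ℝ (⊤ : ℕ∞) p)
    (ha_def : a = fun s => 2 * s * deriv h s + ((l : ℝ) + 1) * h s)
    (hb_def : b = fun s => 2 * (l : ℝ) * deriv h s)
    (hc_def : c = fun s => 2 * deriv a s + b s) (y : E3) :
    ThreadingJets.fluxJetTwo P p 0 y =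
      c (‖y‖ ^ 2) * (a (‖y‖ ^ 2) ^ 2 * angForm Y y - pbr Y (fun z : E3 => inner ℝ z (gradient p z)) y) := by
  -- smoothness of the profiles
  have hh' : ContDiff ℝ (⊤ : ℕ∞) (deriv h) := contDiff_deriv_of_contDiff_top hh
  have ha : ContDiff ℝ (⊤ : ℕ∞) a := by
    rw [ha_def]
    exact ((contDiff_const.mul contDiff_id).mul hh').add (contDiff_const.mul hh)
  have hb : ContDiff ℝ (⊤ : ℕ∞) b := by
    rw [hb_def]
    exact contDiff_const.mul hh'
  have ha' : ContDiff ℝ (⊤ : ℕ∞) (deriv a) := contDiff_deriv_of_contDiff_top ha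
  have hc : ContDiff ℝ (⊤ : ℕ∞) c := by
    rw [hc_def]
    exact (contDiff_const.mul ha').add hb
  have had : Differentiable ℝ a := ha.differentiable (by simp)
  have hbd : Differentiable ℝ b := hb.differentiable (by simp)
  have hcd : Differentiable ℝ c := hc.differentiable (by simp)
  have ha'd : Differentiable ℝ (deriv a) := ha'.differentiable (by simp)
  have hYd : Differentiable ℝ Y := hY.contDiff.differentiable (by simp)
  have hGd : Differentiable ℝ (gradient Y) := hY.contDiff_gradient.differentiable (by simp)
  have hGn : Differentiable ℝ (fun z : E3 => ‖gradient Y z‖ ^ 2) := hGd.norm_sq ℝ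
  have hgp : Differentiable ℝ (gradient p) := (contDiff_gradient_of_contDiff_top hp).differentiable (by simp)
  have hp2 : ContDiff ℝ 2 p := hp.of_le (by norm_cast)
  -- the explicit shell and its toroidal vorticity
  have hPexp : P = fun z : E3 => a (‖z‖ ^ 2) • gradient Y z - (b (‖z‖ ^ 2) * Y z) • z := by
    rw [hPe]
    funext z
    rw [curl_curl_shell_apply (hh.of_le (by norm_cast)) hY z, ha_def, hb_def]
  have hω : curl P = fun z : E3 => -(c (‖z‖ ^ 2) • cross (gradient Y z) z) := by
    rw [hPexp]
    funext z
    rw [curl_explicitShell_apply (ha.of_le (by norm_cast)) (hb.of_le (by norm_cast)) hY z, hc_def]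
  rw [fluxJetTwo_shell_structure hh hY hl hPe hP hdiv hp hω y]
  -- smoothness of the pieces of the tendency `u₁ = −curl curl P − (curl P × P + ∇(|P|²/2)) − ∇p`
  have hωs : ContDiff ℝ (⊤ : ℕ∞) (curl P) := by
    have : ContDiff ℝ ((⊤ : ℕ∞) + 1) P := by simpa using hP
    exact contDiff_curl this
  have hcωs : ContDiff ℝ (⊤ : ℕ∞) (curl (curl P)) := by
    have : ContDiff ℝ ((⊤ : ℕ∞) + 1) (curl P) := by simpa using hωs
    exact contDiff_curl this
  have hcross : ContDiff ℝ (⊤ : ℕ∞) (fun z : E3 => cross (curl P z) (P z)) := by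
    have : ContDiff ℝ (⊤ : ℕ∞) (fun z : E3 => crossCLM (curl P z) (P z)) := crossCLM.contDiff.comp hωs |>.clm_apply hP
    simpa only [crossCLM_apply] using this
  have hq : ContDiff ℝ (⊤ : ℕ∞) (fun w : E3 => ‖P w‖ ^ 2 / 2) := (hP.norm_sq ℝ).div_const 2
  have hq2 : ContDiff ℝ 2 (fun w : E3 => ‖P w‖ ^ 2 / 2) := hq.of_le (by norm_cast)
  have hgq : Differentiable ℝ (gradient (fun w : E3 => ‖P w‖ ^ 2 / 2)) :=
    (contDiff_gradient_of_contDiff_top hq).differentiable (by simp)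
  have hcωd : Differentiable ℝ (curl (curl P)) := hcωs.differentiable (by simp)
  have hcrossd : Differentiable ℝ (fun z : E3 => cross (curl P z) (P z)) := hcross.differentiable (by simp)
  -- (i) `⟪∇Y, curl u₁⟫ = c a {Y,|∇Y|²}`
  have hI : inner ℝ (gradient Y y) (curl (ThreadingJets.nsTendency P p) y) =
      c (‖y‖ ^ 2) * a (‖y‖ ^ 2) * angForm Y y := by
    rw [nsTendency_eq hP hdiv p]
    have d3 : DifferentiableAt ℝ (fun z : E3 => -curl (curl P) z) y := (hcωd y).neg
    have d4 : DifferentiableAt ℝ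
        (fun z : E3 => cross (curl P z) (P z) + gradient (fun w : E3 => ‖P w‖ ^ 2 / 2) z) y := (hcrossd y).add (hgq y)
    have d1 : DifferentiableAt ℝ (fun z : E3 => -curl (curl P) z
        - (cross (curl P z) (P z) + gradient (fun w : E3 => ‖P w‖ ^ 2 / 2) z)) y := d3.sub d4
    rw [curl_sub d1 (hgp y), curl_gradient_eq_zero_holds p hp2 y, sub_zero, curl_sub d3 d4, curl_neg,
      curl_add (hcrossd y) (hgq y), curl_gradient_eq_zero_holds _ hq2 y, add_zero, inner_sub_right, inner_neg_right,
      inner_gradient_curl_curl_curl_eq_zero hY hc hω y, neg_zero, zero_sub]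
    have hcf : (fun z : E3 => cross (curl P z) (P z)) = fun z : E3 =>
        cross (-(c (‖z‖ ^ 2) • cross (gradient Y z) z)) (a (‖z‖ ^ 2) • gradient Y z - (b (‖z‖ ^ 2) * Y z) • z) := by
      funext z
      rw [hω, hPexp]
    rw [hcf, inner_gradient_curl_cross_vorticity_shell hY had hbd hcd y, neg_neg]
  -- (ii) the radial function `⟪u₁, z⟫` in the form `ρ₁(s)|∇Y|² + ρ₂(s)Y² + ρ₃(s)Y − z·∇p`
  obtain ⟨ρ₁, hρ₁⟩ : ∃ ρ₁ : ℝ → ℝ, ρ₁ = fun s =>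
      c s * a s * s - (2 * s * a s * deriv a s + ((l : ℝ) - 1) * a s ^ 2) := ⟨_, rfl⟩
  obtain ⟨ρ₂, hρ₂⟩ : ∃ ρ₂ : ℝ → ℝ, ρ₂ = fun s =>
      -(c s * b s * (l : ℝ) * s) - c s * (a s * (l : ℝ) - b s * s) * (l : ℝ)
        - (b s * s * (2 * s * deriv b s + ((l : ℝ) + 1) * b s) - a s * (l : ℝ) * (2 * s * deriv b s + ((l : ℝ) + 1) * b s)
            - b s * (l : ℝ) * (2 * s * deriv a s + ((l : ℝ) - 1) * a s)) := ⟨_, rfl⟩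
  obtain ⟨ρ₃, hρ₃⟩ : ∃ ρ₃ : ℝ → ℝ, ρ₃ = fun s => ((l : ℝ) * ((l : ℝ) + 1)) * c s := ⟨_, rfl⟩
  have hρ₁d : Differentiable ℝ ρ₁ := by
    rw [hρ₁]
    exact ((hcd.mul had).mul differentiable_id).sub
      (((differentiable_const _ |>.mul differentiable_id).mul had |>.mul ha'd).add ((differentiable_const _).mul (had.pow 2)))
  have hbd' : Differentiable ℝ (deriv b) := (contDiff_deriv_of_contDiff_top hb).differentiable (by simp)
  have hρ₂d : Differentiable ℝ ρ₂ := by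
    rw [hρ₂]
    have hE : Differentiable ℝ (fun s : ℝ => 2 * s * deriv b s + ((l : ℝ) + 1) * b s) :=
      (((differentiable_const _).mul differentiable_id).mul hbd').add ((differentiable_const _).mul hbd)
    have hF : Differentiable ℝ (fun s : ℝ => 2 * s * deriv a s + ((l : ℝ) - 1) * a s) :=
      (((differentiable_const _).mul differentiable_id).mul ha'd).add ((differentiable_const _).mul had)
    exact ((((hcd.mul hbd).mul (differentiable_const _)).mul differentiable_id).neg.sub
      ((hcd.mul ((had.mul (differentiable_const _)).sub (hbd.mul differentiable_id))).mul (differentiable_const _))).sub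
      ((((hbd.mul differentiable_id).mul hE).sub ((had.mul (differentiable_const _)).mul hE)).sub
        ((hbd.mul (differentiable_const _)).mul hF))
  have hρ₃d : Differentiable ℝ ρ₃ := by
    rw [hρ₃]
    exact (differentiable_const _).mul hcd
  have hm : (fun z : E3 => inner ℝ (ThreadingJets.nsTendency P p z) z) = fun z : E3 =>
      ρ₁ (‖z‖ ^ 2) * ‖gradient Y z‖ ^ 2 + ρ₂ (‖z‖ ^ 2) * Y z ^ 2 + ρ₃ (‖z‖ ^ 2) * Y z
        - inner ℝ z (gradient p z) := by
    funext z
    rw [nsTendency_eq hP hdiv p]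
    simp only
    rw [inner_sub_left, inner_sub_left, inner_neg_left, inner_add_left,
      inner_curl_curl_self_of_vorticity hY hl (hc.of_le (by norm_cast)) hω z,
      show cross (curl P z) (P z) = cross (-(c (‖z‖ ^ 2) • cross (gradient Y z) z))
          (a (‖z‖ ^ 2) • gradient Y z - (b (‖z‖ ^ 2) * Y z) • z) by rw [hω, hPexp],
      inner_cross_vorticity_shell_self hY, hPexp, euler_half_norm_sq_explicitShell hY had hbd z,
      real_inner_comm (gradient p z) z, hρ₁, hρ₂, hρ₃]
    ring
  have hII : pbr Y (fun z : E3 => inner ℝ (ThreadingJets.nsTendency P p z) z) y =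
      ρ₁ (‖y‖ ^ 2) * angForm Y y - pbr Y (fun z : E3 => inner ℝ z (gradient p z)) y := by
    rw [hm]
    have e1 : DifferentiableAt ℝ (fun z : E3 => ρ₁ (‖z‖ ^ 2) * ‖gradient Y z‖ ^ 2) y :=
      (differentiableAt_radial hρ₁d y).mul (hGn y)
    have e2 : DifferentiableAt ℝ (fun z : E3 => ρ₂ (‖z‖ ^ 2) * Y z ^ 2) y :=
      (differentiableAt_radial hρ₂d y).mul ((hYd y).pow 2)
    have e3 : DifferentiableAt ℝ (fun z : E3 => ρ₃ (‖z‖ ^ 2) * Y z) y :=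
      (differentiableAt_radial hρ₃d y).mul (hYd y)
    have e4 : DifferentiableAt ℝ (fun z : E3 => inner ℝ z (gradient p z)) y :=
      differentiableAt_id.inner ℝ (hgp y)
    have hY2 : DifferentiableAt ℝ (fun z : E3 => Y z ^ 2) y := (hYd y).pow 2
    have e12 : DifferentiableAt ℝ (fun z : E3 => ρ₁ (‖z‖ ^ 2) * ‖gradient Y z‖ ^ 2 + ρ₂ (‖z‖ ^ 2) * Y z ^ 2) y :=
      e1.add e2
    have e123 : DifferentiableAt ℝ
        (fun z : E3 => ρ₁ (‖z‖ ^ 2) * ‖gradient Y z‖ ^ 2 + ρ₂ (‖z‖ ^ 2) * Y z ^ 2 + ρ₃ (‖z‖ ^ 2) * Y z) y := e12.add e3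
    rw [pbr_sub Y e123 e4, pbr_add Y e12 e3, pbr_add Y e1 e2,
      pbr_radial_mul hρ₁d Y (hGn y), pbr_radial_mul hρ₂d Y hY2, pbr_radial_mul hρ₃d Y (hYd y),
      pbr_self_sq hY, pbr_self, angForm]
    ring
  rw [hI, hII]
  -- (iii) the radial identity
  have hrad : ((l : ℝ) * ((l : ℝ) + 1)) * h (‖y‖ ^ 2) + b (‖y‖ ^ 2) * ‖y‖ ^ 2 - (l : ℝ) * a (‖y‖ ^ 2) = 0 := by
    rw [ha_def, hb_def]
    ring
  have hcs : c (‖y‖ ^ 2) = 2 * deriv a (‖y‖ ^ 2) + b (‖y‖ ^ 2) := by rw [hc_def]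
  have hρ₁s : ρ₁ (‖y‖ ^ 2) = c (‖y‖ ^ 2) * a (‖y‖ ^ 2) * ‖y‖ ^ 2
      - (2 * ‖y‖ ^ 2 * a (‖y‖ ^ 2) * deriv a (‖y‖ ^ 2) + ((l : ℝ) - 1) * a (‖y‖ ^ 2) ^ 2) := by rw [hρ₁]
  rw [hρ₁s]
  linear_combination (angForm Y y * c (‖y‖ ^ 2) * a (‖y‖ ^ 2)) * hrad
    + (angForm Y y * c (‖y‖ ^ 2) * a (‖y‖ ^ 2) * ‖y‖ ^ 2) * hcs

/-! ## §6 The profile read-off `α(r) = a(r²)`, `K(r) = c(r²)` (`r > 0`) -/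

/-- `H′(r) = 2r h′(r²)` for `r > 0` when `H(r) = h(r²)` on `[0,∞)`. [folklore] -/
theorem deriv_profile_of_sq {H h : ℝ → ℝ} (hh : ContDiff ℝ (⊤ : ℕ∞) h) (hHh : ∀ r : ℝ, 0 ≤ r → H r = h (r ^ 2))
    {r : ℝ} (hr : 0 < r) : deriv H r = 2 * r * deriv h (r ^ 2) := by
  have hev : H =ᶠ[𝓝 r] fun r' : ℝ => h (r' ^ 2) := by
    filter_upwards [Ioi_mem_nhds hr] with r' hr' using hHh r' (le_of_lt hr')
  have hsq : HasDerivAt (fun x : ℝ => x ^ 2) (2 * r) r := (hasDerivAt_pow 2 r).congr_deriv (by ring)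
  have h1 : HasDerivAt h (deriv h (r ^ 2)) (r ^ 2) := ((hh.differentiable (by simp)) (r ^ 2)).hasDerivAt
  have hd : HasDerivAt (fun r' : ℝ => h (r' ^ 2)) (deriv h (r ^ 2) * (2 * r)) r :=
    HasDerivAt.comp (h₂ := h) (h := fun x : ℝ => x ^ 2) r h1 hsq
  rw [hev.deriv_eq, hd.deriv]
  ring

/-- `H″(r) = 2h′(r²) + 4r² h″(r²)` for `r > 0` when `H(r) = h(r²)` on `[0,∞)`. [folklore] -/
theorem deriv_deriv_profile_of_sq {H h : ℝ → ℝ} (hh : ContDiff ℝ (⊤ : ℕ∞) h) (hHh : ∀ r : ℝ, 0 ≤ r → H r = h (r ^ 2))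
    {r : ℝ} (hr : 0 < r) : deriv (deriv H) r = 2 * deriv h (r ^ 2) + 4 * r ^ 2 * deriv (deriv h) (r ^ 2) := by
  have hh' : ContDiff ℝ (⊤ : ℕ∞) (deriv h) := contDiff_deriv_of_contDiff_top hh
  have hev : deriv H =ᶠ[𝓝 r] fun r' : ℝ => 2 * r' * deriv h (r' ^ 2) := by
    filter_upwards [Ioi_mem_nhds hr] with r' hr' using deriv_profile_of_sq hh hHh hr'
  have hsq : HasDerivAt (fun x : ℝ => x ^ 2) (2 * r) r := (hasDerivAt_pow 2 r).congr_deriv (by ring)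
  have h1 : HasDerivAt (deriv h) (deriv (deriv h) (r ^ 2)) (r ^ 2) := ((hh'.differentiable (by simp)) (r ^ 2)).hasDerivAt
  have hd : HasDerivAt (fun r' : ℝ => deriv h (r' ^ 2)) (deriv (deriv h) (r ^ 2) * (2 * r)) r :=
    HasDerivAt.comp (h₂ := deriv h) (h := fun x : ℝ => x ^ 2) r h1 hsq
  have hlin : HasDerivAt (fun r' : ℝ => 2 * r') 2 r := by
    simpa using (hasDerivAt_id r).const_mul (2 : ℝ)
  have hprod : HasDerivAt (fun r' : ℝ => 2 * r' * deriv h (r' ^ 2))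
      (2 * deriv h (r ^ 2) + 2 * r * (deriv (deriv h) (r ^ 2) * (2 * r))) r := hlin.mul hd
  rw [hev.deriv_eq, hprod.deriv]
  ring

/-- READ-OFF OF THE STRAIN AMPLITUDE: `α_l[H](r) = a(r²)`, `a(s) = 2 s h′(s) + (l+1) h(s)`, for `r > 0`. [folklore] -/
theorem strainAmpL_eq_of_sq (l : ℕ) {H h : ℝ → ℝ} (hh : ContDiff ℝ (⊤ : ℕ∞) h) (hHh : ∀ r : ℝ, 0 ≤ r → H r = h (r ^ 2))
    {r : ℝ} (hr : 0 < r) :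
    strainAmpL l H r = 2 * r ^ 2 * deriv h (r ^ 2) + ((l : ℝ) + 1) * h (r ^ 2) := by
  unfold strainAmpL
  rw [deriv_profile_of_sq hh hHh hr, hHh r hr.le]
  ring

/-- READ-OFF OF THE VORTICITY AMPLITUDE: `K_l[H](r) = 4r² h″(r²) + (4l+6) h′(r²)` for `r > 0`. [folklore] -/
theorem vortAmpL_eq_of_sq (l : ℕ) {H h : ℝ → ℝ} (hh : ContDiff ℝ (⊤ : ℕ∞) h) (hHh : ∀ r : ℝ, 0 ≤ r → H r = h (r ^ 2))
    {r : ℝ} (hr : 0 < r) :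
    vortAmpL l H r = 4 * r ^ 2 * deriv (deriv h) (r ^ 2) + (4 * (l : ℝ) + 6) * deriv h (r ^ 2) := by
  unfold vortAmpL
  rw [deriv_deriv_profile_of_sq hh hHh hr, deriv_profile_of_sq hh hHh hr]
  field_simp
  ring

/-- the derivative of the profile `a(s) = 2 s h′ + (l+1) h`: `a′ = 2 s h″ + (l+3) h′`. [folklore] -/
theorem deriv_strainProfile {h : ℝ → ℝ} (hh : ContDiff ℝ (⊤ : ℕ∞) h) (l : ℕ) (s : ℝ) :
    deriv (fun s : ℝ => 2 * s * deriv h s + ((l : ℝ) + 1) * h s) s =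
      2 * s * deriv (deriv h) s + ((l : ℝ) + 3) * deriv h s := by
  have hh' : ContDiff ℝ (⊤ : ℕ∞) (deriv h) := contDiff_deriv_of_contDiff_top hh
  have h1 : HasDerivAt (deriv h) (deriv (deriv h) s) s := ((hh'.differentiable (by simp)) s).hasDerivAt
  have h0 : HasDerivAt h (deriv h s) s := ((hh.differentiable (by simp)) s).hasDerivAt
  have hlin : HasDerivAt (fun r' : ℝ => 2 * r') 2 s := by
    simpa using (hasDerivAt_id s).const_mul (2 : ℝ)
  have hsum : HasDerivAt (fun s : ℝ => 2 * s * deriv h s + ((l : ℝ) + 1) * h s)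
      (2 * deriv h s + 2 * s * deriv (deriv h) s + ((l : ℝ) + 1) * deriv h s) s :=
    (hlin.mul h1).add (h0.const_mul _)
  rw [hsum.deriv]
  ring

/-! ## §7 Translation to the centre `x₀` and ★ half (A) by name -/

/-- `∇(f(· − a))(x) = ∇f(x − a)`. [folklore] -/
theorem gradient_comp_sub_const (f : E3 → ℝ) (a x : E3) : gradient (fun z : E3 => f (z - a)) x = gradient f (x - a) := by
  unfold gradient
  rw [fderiv_comp_sub]

/-- THE SECOND JET ABOUT `x₀` IS THE CENTRED SECOND JET: for the shell about `x₀` (the translate of the centred shell `P`) and any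
pressure slice `p₀`, `fluxJetTwo (sepShellL H Y x₀) p₀ x₀ (x₀ + y) = fluxJetTwo P (p₀(x₀ + ·)) 0 y`
(Laplacian, convective derivative, gradient and curl commute with translations). [folklore] -/
theorem fluxJetTwo_sepShellL_translate {H h : ℝ → ℝ} (hHh : ∀ r : ℝ, 0 ≤ r → H r = h (r ^ 2)) (Y : E3 → ℝ)
    (x₀ : E3) (p₀ : E3 → ℝ) (y : E3) :
    ThreadingJets.fluxJetTwo (sepShellL H Y x₀) p₀ x₀ (x₀ + y) =
      ThreadingJets.fluxJetTwo (curl (curl (fun z : E3 => (h (‖z‖ ^ 2) * Y z) • z))) (fun z : E3 => p₀ (x₀ + z)) 0 y := by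
  obtain ⟨P, hPe⟩ : ∃ P : E3 → E3, P = curl (curl (fun z : E3 => (h (‖z‖ ^ 2) * Y z) • z)) := ⟨_, rfl⟩
  obtain ⟨p, hpe⟩ : ∃ p : E3 → ℝ, p = fun z : E3 => p₀ (x₀ + z) := ⟨_, rfl⟩
  rw [← hPe, ← hpe]
  have hv : sepShellL H Y x₀ = fun x : E3 => P (x - x₀) := by
    rw [hPe]
    exact sepShellL_eq_comp_sub hHh Y x₀
  have hp₀ : p₀ = fun x : E3 => p (x - x₀) := by
    funext x
    rw [hpe]
    simp only [add_sub_cancel]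
  -- the tendency translates
  obtain ⟨u, hu⟩ : ∃ u : E3 → E3, u = ThreadingJets.nsTendency P p := ⟨_, rfl⟩
  have hU : ThreadingJets.nsTendency (sepShellL H Y x₀) p₀ = fun x : E3 => u (x - x₀) := by
    funext x
    rw [hu]
    unfold ThreadingJets.nsTendency
    rw [hv, laplacian_comp_sub_const P x₀ x, convect_apply, convect_apply, fderiv_comp_sub, hp₀,
      gradient_comp_sub_const]
  -- the second-jet field translates
  obtain ⟨G, hG⟩ : ∃ G : E3 → E3, G = fun w : E3 => (Δ u) w - (convect P u w + convect u P w) := ⟨_, rfl⟩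
  have hin : (fun z : E3 => (Δ (ThreadingJets.nsTendency (sepShellL H Y x₀) p₀)) z
      - (convect (sepShellL H Y x₀) (ThreadingJets.nsTendency (sepShellL H Y x₀) p₀) z
        + convect (ThreadingJets.nsTendency (sepShellL H Y x₀) p₀) (sepShellL H Y x₀) z)) =
      fun z : E3 => G (z - x₀) := by
    funext z
    rw [hU, hv, hG]
    simp only [laplacian_comp_sub_const u x₀ z, convect_apply, fderiv_comp_sub]
  unfold ThreadingJets.fluxJetTwo
  rw [hin, curl_comp_sub_const_fun G x₀, ← hu, ← hG]
  simp only [add_sub_cancel_left, sub_zero]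

/-- the bracket vanishes at the centre: `{f, g}(0) = 0`. [folklore] -/
theorem pbr_apply_zero (f g : E3 → ℝ) : pbr f g 0 = 0 := by
  simp [pbr, det3]

/-- ★ HALF (A) OF THE ORDER-TWO SLICE LAW, BY NAME (`ThreadingJets.OrderTwoLawSlice`, director-ns dss_146): for the separable shell
`u₀ = sepShellL H Y x₀` of a solid harmonic `Y` of degree `l ≥ 1` with a virial-admissible profile `H` and ANY smooth pressure
slice `p₀`, `fluxJetTwo u₀ p₀ x₀ (x₀ + y) = K(|y|) · (α(|y|)² {Y,|∇Y|²}(y) − {Y, y·∇p₀(x₀ + ·)}(y))`.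
(`orderTwoLaw_centred` + the read-off `α(r) = a(r²)`, `K(r) = c(r²)` for `r > 0`; at `y = 0` both sides vanish.) -/
theorem orderTwoLawSlice_holds : ThreadingJets.OrderTwoLawSlice := by
  intro l x₀ Y H p₀ hl hY hH hs hdivs hp₀ y
  obtain ⟨h, hh, hHh⟩ := hH.1
  rw [fluxJetTwo_sepShellL_translate hHh Y x₀ p₀ y]
  -- the centred shell and the translated pressure
  obtain ⟨P, hPe⟩ : ∃ P : E3 → E3, P = curl (curl (fun z : E3 => (h (‖z‖ ^ 2) * Y z) • z)) := ⟨_, rfl⟩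
  obtain ⟨p, hpe⟩ : ∃ p : E3 → ℝ, p = fun z : E3 => p₀ (x₀ + z) := ⟨_, rfl⟩
  rw [← hPe, ← hpe]
  have hF : ContDiff ℝ (⊤ : ℕ∞) (fun z : E3 => (h (‖z‖ ^ 2) * Y z) • z) := contDiff_shell hh hY
  have hcF : ContDiff ℝ (⊤ : ℕ∞) (curl (fun z : E3 => (h (‖z‖ ^ 2) * Y z) • z)) := by
    have : ContDiff ℝ ((⊤ : ℕ∞) + 1) (fun z : E3 => (h (‖z‖ ^ 2) * Y z) • z) := by simpa using hF
    exact contDiff_curl this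
  have hP : ContDiff ℝ (⊤ : ℕ∞) P := by
    have : ContDiff ℝ ((⊤ : ℕ∞) + 1) (curl (fun z : E3 => (h (‖z‖ ^ 2) * Y z) • z)) := by simpa using hcF
    rw [hPe]
    exact contDiff_curl this
  have hdiv : VectorCalculus.IsDivFree P := by
    intro z
    rw [hPe]
    exact divergence_curl_eq_zero_holds _ (hcF.of_le (by norm_cast)) z
  have hp : ContDiff ℝ (⊤ : ℕ∞) p := by
    rw [hpe]
    exact hp₀.comp (contDiff_const.add contDiff_id)
  have hgradp : (fun z : E3 => inner ℝ z (gradient p z)) = fun z : E3 => inner ℝ z (gradient p₀ (x₀ + z)) := by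
    funext z
    rw [hpe, gradient, gradient, fderiv_comp_add_left]
  -- the centred law
  obtain ⟨a, ha_def⟩ : ∃ a : ℝ → ℝ, a = fun s => 2 * s * deriv h s + ((l : ℝ) + 1) * h s := ⟨_, rfl⟩
  obtain ⟨b, hb_def⟩ : ∃ b : ℝ → ℝ, b = fun s => 2 * (l : ℝ) * deriv h s := ⟨_, rfl⟩
  obtain ⟨c, hc_def⟩ : ∃ c : ℝ → ℝ, c = fun s => 2 * deriv a s + b s := ⟨_, rfl⟩
  rw [orderTwoLaw_centred hh hY hl hPe hP hdiv hp ha_def hb_def hc_def y, hgradp]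
  -- read-off
  rcases eq_or_ne y 0 with hy | hy
  · subst hy
    simp only [angForm, pbr_apply_zero, mul_zero, sub_zero]
  · have hr : 0 < ‖y‖ := norm_pos_iff.mpr hy
    have hα : strainAmpL l H ‖y‖ = a (‖y‖ ^ 2) := by
      rw [strainAmpL_eq_of_sq l hh hHh hr, ha_def]
    have hK : vortAmpL l H ‖y‖ = c (‖y‖ ^ 2) := by
      rw [vortAmpL_eq_of_sq l hh hHh hr, hc_def, hb_def]
      simp only [ha_def]
      rw [deriv_strainProfile hh l]
      ring
    rw [hα, hK]

/-- THE `l = 2` READING (g10-2 PROFILE HORN vocabulary): for a quadratic form `Q` (symmetric, traceless), a horn-admissible profile `H`,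
the shell `sepShell H Q x₀` (smooth, divergence free) and ANY smooth `p₀`:
`fluxJetTwo (sepShell H Q x₀) p₀ x₀ (x₀ + y) = K(|y|) · (16 α(|y|)² D_Q(y) − {Y_Q, y·∇p₀(x₀ + ·)}(y))` (`𝒜(Y_Q) = 16 D_Q`, `angForm_quadY`).
Bridge PH's `HornSliceIdentityTwo` is this plus the `l = 2` pressure bracket for the decaying solution of the slice Poisson equation. -/
theorem fluxJetTwo_sepShell_eq {Q : Matrix (Fin 3) (Fin 3) ℝ} {H : ℝ → ℝ} (hQ : ProfileHorn.IsQuadForm Q)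
    (hH : ProfileHorn.HornAdmissible H) (x₀ : E3) (hs : ContDiff ℝ (⊤ : ℕ∞) (ProfileHorn.sepShell H Q x₀))
    (hdiv : VectorCalculus.IsDivFree (ProfileHorn.sepShell H Q x₀)) {p₀ : E3 → ℝ} (hp₀ : ContDiff ℝ (⊤ : ℕ∞) p₀) (y : E3) :
    ThreadingJets.fluxJetTwo (ProfileHorn.sepShell H Q x₀) p₀ x₀ (x₀ + y) =
      ProfileHorn.vortAmp H ‖y‖ * (16 * ProfileHorn.strainAmp H ‖y‖ ^ 2 * ProfileHorn.discrCubic Q y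
        - pbr (ProfileHorn.quadY Q) (fun z : E3 => inner ℝ z (gradient p₀ (x₀ + z))) y) := by
  have h := orderTwoLawSlice_holds 2 x₀ (ProfileHorn.quadY Q) H p₀ (by norm_num) (isSolidHarmonic_quadY hQ)
    (virialAdmissible_two_of_hornAdmissible hH) hs hdiv hp₀ y
  rw [sepShell_eq_sepShellL, strainAmp_eq_strainAmpL, vortAmp_eq_vortAmpL, h, angForm_quadY hQ.1]
  ring

end Summit.NavierStokesRegularity.NavierStokesRegularity.Theorems.UnthreadedRigidity.VirialHorn
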